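import Summits.QuantumFields.YangMills.Theorems.PoincareLipschitzMeanDeviationOfSecondMoment
import Summits.QuantumFields.YangMills.Theorems.PoincareLipschitzQuantileOfMeanDeviation
import Summits.QuantumFields.YangMills.Theorems.RevelationMartingaleMeanDeviationSplit
import Summits.QuantumFields.YangMills.Theorems.PoincareLipschitzHistoryTailOfTangentMapFact
import HarnessLib

/-!
# Routes `PoincareLipschitz` ∕ `RevelationMartingale` — helper (SH): THE SHALLOW∕DEEP SPLIT OF THE VARIANCE ROW, THEOREMS-SIDE
# (crux idea «gross-sd-transfer», LINE 28 candidate of `Cruxes/HistoryTailL/Ideas/gross-sd-transfer.md`, ideator ym-r3-idea-2 g15; its FIRST LEMMA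
# `GrossTransfer.firstLemma_shallowFluxSecondMoment` of the sketch `Sketch28.lean` (sha16 3afb7c02a7c55089) is the displayed binder `hSh` below, VERBATIM)

LINE 28 (Gross's Schwinger–Dyson Gaussian domination transplanted to SU(2)) promises the second-moment bound for ONE block-averaged plaquette

  «ShallowFluxSecondMomentL»  `∀ L ∃ N₁ > 0 ∃ C ≥ 0 ∃ γ₁ ∈ (0,1] ∀ F (F.L = L) ∀ 0 < γ ≤ γ₁ ∀ K j, 1 ≤ j → N₁·j ≤ K → ∀ a : Plaq (F.P K) j,`
                               `∫ dist₁(plaqHol(Ū^j U) a)² d(gibbsK F ℰp γ K) ≤ C · (γ · (F.L)^{−(K−j)})`            (= `C·g_{K−j}²`)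

ONLY on the SHALLOW range `N₁·j ≤ K` (card: «deep levels `N₁·j > K` are NOT touched … that is where Bałaban's scale-by-scale RG is unavoidable»), whereas the
K2-lane face of record v10 (✓ `PoincareLipschitzHistoryTailOfSecondMoment`, LEAD ★w1-19936 g10) and ✓ `PoincareLipschitzMeanDeviationOfSecondMoment` (px9 g9) read
the variance row ALL-SCALES («BlockSecondMomentL», `1 ≤ j ≤ K`).  This file keeps the book honest about that difference, BY NAME:

* ★★★ `meanDeviationShallowL_of_shallowSecondMoment (hSh) : Theses.RevelationMartingale.MeanDeviationShallowL` — the registered crux stmt-QuantumFields-23133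
  (LINE 27's target) follows from LINE 28's first lemma ALONE, with the lemma's own depth fraction `N₁` (AM–GM via ✓ `integral_le_of_sq_integral` after the
  ROOM lemma ✓ `const_mul_coupling_le_θBal_sq`: `C·g² ≤ θBal²∕256` once `γ ≤ exp(−32√C∕b₀)`);
* ★★ `meanDeviationL_of_shallowSecondMoment_deep (hSh) (hDeep : Theses.RevelationMartingale.MeanDeviationDeepL) : Theses.RevelationMartingale.MeanDeviationL`
  (and the `Theses.PoincareLipschitz` spelling `…_deep'`) — the parent crux stmt-QuantumFields-23083 follows from the shallow lemma AND the organ-adjacent DEEP crux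
  stmt-QuantumFields-23134, through the landed glue ✓ `revelationMartingale_meanDeviationLGlue_proof` (stmt-QuantumFields-23135);
* ★★ `quantileDeviation_of_shallowSecondMoment_deep (hSh) (hDeep) : ⟨(Q)⟩` — the text of LINE 27's one active registered stub `stub_quantileDeviation` of
  `Cruxes/HistoryTailL/Lines/median_centring.lean` VERBATIM, via ✓ `MedianCentring.quantile_of_meanDeviation` (px10 g6, T-7);
* ★ `shallowQuantile_of_shallowSecondMoment (hSh)` — (Q)'s inequality on the shallow range `N₁·j ≤ K` directly (Chebyshev at `θBal(K−j)∕8`,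
  ✓ `threeQuarters_of_sq_integral`), the shape LINE 27's (T)∕(M) consume shallow-side;
* ★★ `historyTailL_of_tangentMapFact_shallowSecondMoment_deep (hK1) (hT) (hSh) (hDeep) : Theses.UnitScaleTilt.HistoryTailL` — the COROLLARY (not a
  display: faces are the LEAD's ∕ ★★OWNER's, RULING №28) obtained by feeding `…_deep'` to the K2-lane face ✓ `historyTailL_of_tangentMapFact` (LEAD K-13):
  the crux stmt-QuantumFields-19936 ⟸ {K1-exp, `MinimisingTangentMapConstant` [SU84 Prop 1.2], LINE 28's shallow lemma, `MeanDeviationDeepL`} — FOUR open ∕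
  print rows, i.e. the v10 face ✓ `historyTailL_of_tangentMapFact_secondMoment` with its all-scales variance row cut at LINE 28's own depth line.

So, in one kernel sentence each: 23133 ⟸ LINE 28's first lemma; 23083 and (Q) ⟸ {LINE 28's first lemma, `MeanDeviationDeepL`}; 19936 ⟸ {K1-exp, SU84 Prop 1.2,
LINE 28's first lemma, `MeanDeviationDeepL`}.  A later LINE 28 item
re-points `hSh` by ONE `exact`; the deep half stays visibly on 23134.

HONEST SCOPE: CONDITIONAL doors; `hSh` is an OPEN, UNREGISTERED statement (a crux IDEA's first lemma — Gaussian-size second moment at shallow depth; its U(1)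
analogue is Gross 1983 Thm 2.2; NOT printed for non-abelian d = 3); `MeanDeviationDeepL` is an OPEN crux (first-moment UV stability in mean, printed only inside
Bałaban's induction [Balaban1985UV3] (71)); NOTHING of (Q), 23083, 23133, 23134, K1, K2, `HistoryTailL`, or the rung R3 (YM₃ on T³ — NOT d = 4, NOT infinite
volume, NOT a mass gap, NOT Clay) is proved here; the Yang–Mills mass gap is NOT proved.

Width seat ym3-torus-px10 g7 (cell ym3-torus, WIDTH COPY «width 10»), `--supports stmt-QuantumFields-23133 --as helper`; THEOREMS ONLY (0 `def`, 0 `sorry`).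
References: T. Bałaban, Commun. Math. Phys. **102** (1985) 255–275 [Balaban1985UV3] ((3) p.256, (7) p.257, (71) p.273); L. Gross, Commun. Math. Phys. **92**
(1983) 137–162, Thm 2.2 [GrossCMP1983].
-/

set_option autoImplicit false

namespace Summit.QuantumFields.YangMills.Theorems.PoincareLipschitzMeanDeviationOfShallowSecondMoment

open MeasureTheory
open scoped BigOperators
open Literature.MathematicalPhysics.QuantumFieldTheory.Balaban1983to89
open Literature.MathematicalPhysics.QuantumFieldTheory.Balaban1983to89.T3ContinuumYM3Torus
open Literature.MathematicalPhysics.QuantumFieldTheory.Balaban1983to89.T3UnitScaleTilt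
open Literature.MathematicalPhysics.QuantumFieldTheory.Balaban1983to89.T3UnitLawDensityEML (ℰp measurableE_ℰp)
open Literature.MathematicalPhysics.QuantumFieldTheory.Balaban1983to89.T3MinimiserStabilityReduction (θBal_pos)
open Summit.QuantumFields.YangMills.Theorems.PoincareLipschitzMeanDeviationOfSecondMoment
  (integral_le_of_sq_integral threeQuarters_of_sq_integral const_mul_coupling_le_θBal_sq)

/-! ## §1 The shallow second-moment datum at threshold scale -/

/-- **«ShallowFluxSecondMomentL» ⇒ the second moment at THRESHOLD scale on the shallow range.**  For every `L` there is a depth fraction `N₁` (the lemma's own)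
such that for every profile `(b₀, p₀)` (`b₀ > 0`, `p₀ > 2`): `∫ d² ≤ θBal(K−j)²∕256` at all `1 ≤ j`, `N₁·j ≤ K`, uniformly in the family, for `γ` below a
profile-dependent `γ₁` (the ROOM lemma ✓ `const_mul_coupling_le_θBal_sq`). [cite: Balaban1985UV3, (7) p.257] -/
theorem secondMomentTheta_of_shallowSecondMoment
    (hSh : ∀ (L : ℕ), ∃ N₁ : ℕ, 0 < N₁ ∧ ∃ C : ℝ, 0 ≤ C ∧ ∃ γ₁ : ℝ, 0 < γ₁ ∧ γ₁ ≤ 1 ∧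
      ∀ (F : T3Family) (γ : ℝ), F.L = L → 0 < γ → γ ≤ γ₁ → ∀ (K j : ℕ), 1 ≤ j → N₁ * j ≤ K →
        ∀ a : Plaq (F.P K) j,
          ∫ U, (GaugeGroup.dist1 (GaugeField.plaqHol
              (Averaging.iter (fun i' => BlockAveraging.blockAvg (P := F.P K) (j := i') ℰp) j U) a)) ^ 2 ∂(gibbsK F ℰp γ K)
            ≤ C * (γ * ((F.L : ℝ)⁻¹) ^ (K - j)))
    (L : ℕ) :
    ∃ N₁ : ℕ, 0 < N₁ ∧ ∀ (b₀ p₀ : ℝ), 0 < b₀ → 2 < p₀ → ∃ γ₁ : ℝ, 0 < γ₁ ∧ γ₁ ≤ 1 ∧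
      ∀ (F : T3Family) (γ : ℝ), F.L = L → 0 < γ → γ ≤ γ₁ → ∀ (K j : ℕ), 1 ≤ j → N₁ * j ≤ K →
        ∀ a : Plaq (F.P K) j,
          ∫ U, (GaugeGroup.dist1 (GaugeField.plaqHol
              (Averaging.iter (fun i' => BlockAveraging.blockAvg (P := F.P K) (j := i') ℰp) j U) a)) ^ 2 ∂(gibbsK F ℰp γ K)
            ≤ θBal F.L γ b₀ p₀ (K - j) ^ 2 / 256 := by
  obtain ⟨N₁, hN₁, C, hC, γV, hγV, hγV1, HV⟩ := hSh L
  refine ⟨N₁, hN₁, fun b₀ p₀ hb₀ hp₀ => ?_⟩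
  by_cases hL : 1 ≤ L
  swap
  · refine ⟨1, one_pos, le_rfl, fun F γ hFL => ?_⟩
    exact absurd (hFL ▸ F.hL.2) (by omega)
  obtain ⟨γR, hγR, hγR1, HR⟩ := const_mul_coupling_le_θBal_sq hL hb₀ (by linarith : (1 : ℝ) ≤ p₀) hC
  refine ⟨min γV γR, lt_min hγV hγR, (min_le_left _ _).trans hγV1, ?_⟩
  intro F γ hFL hγ hγle K j hj hjK a
  have h1 := HV F γ hFL hγ (hγle.trans (min_le_left _ _)) K j hj hjK a
  have h2 := HR γ hγ (hγle.trans (min_le_right _ _)) (K - j)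
  rw [hFL] at h1 ⊢
  exact h1.trans h2

/-! ## §2 The registered shallow crux from the shallow lemma alone -/

/-- ★★★ **«ShallowFluxSecondMomentL» ⇒ `MeanDeviationShallowL`** (stmt-QuantumFields-23133, LINE 27's registered target; routes RevelationMartingale ∕
PoincareLipschitz) — from LINE 28's first lemma ALONE, with its own depth fraction `N₁`, by AM–GM at the ROOM's `γ₁`: `∫ dist₁ ≤ θBal(K−j)∕16 ≤ θBal(K−j)∕2`.
CONDITIONAL on the displayed binder `hSh` (an OPEN crux-idea lemma; U(1) analogue = Gross's Gaussian domination; NOT printed for non-abelian d = 3).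
[cite: Balaban1985UV3, (3) p.256 and (7) p.257] [cite: GrossCMP1983, Thm 2.2] -/
theorem meanDeviationShallowL_of_shallowSecondMoment
    (hSh : ∀ (L : ℕ), ∃ N₁ : ℕ, 0 < N₁ ∧ ∃ C : ℝ, 0 ≤ C ∧ ∃ γ₁ : ℝ, 0 < γ₁ ∧ γ₁ ≤ 1 ∧
      ∀ (F : T3Family) (γ : ℝ), F.L = L → 0 < γ → γ ≤ γ₁ → ∀ (K j : ℕ), 1 ≤ j → N₁ * j ≤ K →
        ∀ a : Plaq (F.P K) j,
          ∫ U, (GaugeGroup.dist1 (GaugeField.plaqHol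
              (Averaging.iter (fun i' => BlockAveraging.blockAvg (P := F.P K) (j := i') ℰp) j U) a)) ^ 2 ∂(gibbsK F ℰp γ K)
            ≤ C * (γ * ((F.L : ℝ)⁻¹) ^ (K - j))) :
    Summit.QuantumFields.YangMills.Theses.RevelationMartingale.MeanDeviationShallowL := by
  intro L
  obtain ⟨N₁, hN₁, H⟩ := secondMomentTheta_of_shallowSecondMoment hSh L
  refine ⟨N₁, hN₁, fun b₀ p₀ hb₀ hp₀ => ?_⟩
  obtain ⟨γ₁, hγ₁, hγ₁1, H1⟩ := H b₀ p₀ hb₀ hp₀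
  refine ⟨γ₁, hγ₁, hγ₁1, ?_⟩
  intro F γ hFL hγ hγle K j hj hjK a
  have hsq := H1 F γ hFL hγ hγle K j hj hjK a
  haveI : IsProbabilityMeasure (gibbsK F ℰp γ K) := isProbabilityMeasure_gibbsK F ℰp hγ.le K
  have hL1 : 1 ≤ F.L := le_of_lt F.hL.2
  have hθpos : 0 < θBal F.L γ b₀ p₀ (K - j) := θBal_pos hL1 hγ (hγle.trans hγ₁1) hb₀ p₀ (K - j)
  have hfm : Measurable fun U : GaugeField (F.P K) 0 (Matrix.specialUnitaryGroup (Fin 2) ℂ) =>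
      GaugeGroup.dist1 (GaugeField.plaqHol (Averaging.iter (fun i' => BlockAveraging.blockAvg (P := F.P K) (j := i') ℰp) j U) a) :=
    RegularGaugeGroup.measurable_dist1.comp ((Missing.measurable_plaqHol a).comp
      (T4Continuum.measurable_iter _ (F.avgMeasurable_of_measurableE ℰp measurableE_ℰp K) j))
  have h := integral_le_of_sq_integral (μ := gibbsK F ℰp γ K) hθpos hfm (fun U => GaugeGroup.dist1_nonneg _)
    (fun U => T4PairDerivBridge.dist1_le_two_specialUnitaryGroup _) hsq
  linarith

/-! ## §3 The parent crux and (Q) from the shallow lemma and the deep crux -/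

/-- ★★ **«ShallowFluxSecondMomentL» ∧ `MeanDeviationDeepL` ⇒ `MeanDeviationL`** (stmt-QuantumFields-23083, `Theses.RevelationMartingale` spelling): the shallow
half by `meanDeviationShallowL_of_shallowSecondMoment`, the deep half (`K < N₁·j`, first-moment UV stability in mean — OPEN crux stmt-QuantumFields-23134) as a
hypothesis, recomposed by the landed glue ✓ `revelationMartingale_meanDeviationLGlue_proof` (stmt-QuantumFields-23135).  CONDITIONAL on both binders.
[cite: Balaban1985UV3, (7) p.257 and (71) p.273] -/
theorem meanDeviationL_of_shallowSecondMoment_deep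
    (hSh : ∀ (L : ℕ), ∃ N₁ : ℕ, 0 < N₁ ∧ ∃ C : ℝ, 0 ≤ C ∧ ∃ γ₁ : ℝ, 0 < γ₁ ∧ γ₁ ≤ 1 ∧
      ∀ (F : T3Family) (γ : ℝ), F.L = L → 0 < γ → γ ≤ γ₁ → ∀ (K j : ℕ), 1 ≤ j → N₁ * j ≤ K →
        ∀ a : Plaq (F.P K) j,
          ∫ U, (GaugeGroup.dist1 (GaugeField.plaqHol
              (Averaging.iter (fun i' => BlockAveraging.blockAvg (P := F.P K) (j := i') ℰp) j U) a)) ^ 2 ∂(gibbsK F ℰp γ K)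
            ≤ C * (γ * ((F.L : ℝ)⁻¹) ^ (K - j)))
    (hDeep : Summit.QuantumFields.YangMills.Theses.RevelationMartingale.MeanDeviationDeepL) :
    Summit.QuantumFields.YangMills.Theses.RevelationMartingale.MeanDeviationL :=
  Summit.QuantumFields.YangMills.Theorems.revelationMartingale_meanDeviationLGlue_proof
    (meanDeviationShallowL_of_shallowSecondMoment hSh) hDeep

/-- ★★ The same door in the `Theses.PoincareLipschitz` spelling of the shared item stmt-QuantumFields-23083 (the two route files display the same text;
definitional unfolding).  CONDITIONAL on both binders. [cite: Balaban1985UV3, (7) p.257 and (71) p.273] -/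
theorem meanDeviationL_of_shallowSecondMoment_deep'
    (hSh : ∀ (L : ℕ), ∃ N₁ : ℕ, 0 < N₁ ∧ ∃ C : ℝ, 0 ≤ C ∧ ∃ γ₁ : ℝ, 0 < γ₁ ∧ γ₁ ≤ 1 ∧
      ∀ (F : T3Family) (γ : ℝ), F.L = L → 0 < γ → γ ≤ γ₁ → ∀ (K j : ℕ), 1 ≤ j → N₁ * j ≤ K →
        ∀ a : Plaq (F.P K) j,
          ∫ U, (GaugeGroup.dist1 (GaugeField.plaqHol
              (Averaging.iter (fun i' => BlockAveraging.blockAvg (P := F.P K) (j := i') ℰp) j U) a)) ^ 2 ∂(gibbsK F ℰp γ K)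
            ≤ C * (γ * ((F.L : ℝ)⁻¹) ^ (K - j)))
    (hDeep : Summit.QuantumFields.YangMills.Theses.RevelationMartingale.MeanDeviationDeepL) :
    Summit.QuantumFields.YangMills.Theses.PoincareLipschitz.MeanDeviationL := by
  have h := meanDeviationL_of_shallowSecondMoment_deep hSh hDeep
  unfold Summit.QuantumFields.YangMills.Theses.RevelationMartingale.MeanDeviationL at h
  unfold Summit.QuantumFields.YangMills.Theses.PoincareLipschitz.MeanDeviationL
  exact h

/-- ★★ **«ShallowFluxSecondMomentL» ∧ `MeanDeviationDeepL` ⇒ (Q)** — the conclusion is the text of `stub_quantileDeviation` of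
`Cruxes/HistoryTailL/Lines/median_centring.lean` VERBATIM (stmt-QuantumFields-23133's one active registered stub; the `hQ` row of the K2-lane faces v8∕v9),
via ✓ `MedianCentring.quantile_of_meanDeviation` (Markov at profile `b₀∕16`).  CONDITIONAL on both binders. [cite: Balaban1985UV3, (7) p.257 and (71) p.273] -/
theorem quantileDeviation_of_shallowSecondMoment_deep
    (hSh : ∀ (L : ℕ), ∃ N₁ : ℕ, 0 < N₁ ∧ ∃ C : ℝ, 0 ≤ C ∧ ∃ γ₁ : ℝ, 0 < γ₁ ∧ γ₁ ≤ 1 ∧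
      ∀ (F : T3Family) (γ : ℝ), F.L = L → 0 < γ → γ ≤ γ₁ → ∀ (K j : ℕ), 1 ≤ j → N₁ * j ≤ K →
        ∀ a : Plaq (F.P K) j,
          ∫ U, (GaugeGroup.dist1 (GaugeField.plaqHol
              (Averaging.iter (fun i' => BlockAveraging.blockAvg (P := F.P K) (j := i') ℰp) j U) a)) ^ 2 ∂(gibbsK F ℰp γ K)
            ≤ C * (γ * ((F.L : ℝ)⁻¹) ^ (K - j)))
    (hDeep : Summit.QuantumFields.YangMills.Theses.RevelationMartingale.MeanDeviationDeepL) :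
    ∀ (L : ℕ) (b₀ p₀ : ℝ), 0 < b₀ → 2 < p₀ → ∃ γ₁ : ℝ, 0 < γ₁ ∧ γ₁ ≤ 1 ∧ ∀ (F : T3Family) (γ : ℝ), F.L = L → 0 < γ → γ ≤ γ₁ →
          ∀ (K j : ℕ), 1 ≤ j → j + 2 ≤ K → ∀ a : Plaq (F.P K) j,
            3 / 4 ≤ (gibbsK F ℰp γ K).real {U : GaugeField (F.P K) 0 (Matrix.specialUnitaryGroup (Fin 2) ℂ) | GaugeGroup.dist1 (GaugeField.plaqHol (Averaging.iter (fun i' => BlockAveraging.blockAvg (P := F.P K) (j := i') ℰp) j U) a) ≤ θBal F.L γ b₀ p₀ (K - j) / 8} :=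
  Summit.QuantumFields.YangMills.Theorems.PoincareLipschitz.MedianCentring.quantile_of_meanDeviation
    (meanDeviationL_of_shallowSecondMoment_deep' hSh hDeep)

/-! ## §4 (Q)'s inequality on the shallow range, from the shallow lemma alone -/

/-- ★ **«ShallowFluxSecondMomentL» ⇒ the 3∕4-quantile on the shallow range** — (Q)'s inequality `Gibbs_K{dist₁(Ū^j(∂a)) ≤ θBal(K−j)∕8} ≥ 3∕4` at all depths
`1 ≤ j`, `N₁·j ≤ K` (the lemma's own `N₁`), by Chebyshev at `θBal(K−j)∕8` (✓ `threeQuarters_of_sq_integral`) at the ROOM's `γ₁`; no deep input, no K1∕K2.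
NOT the registered (Q) text (which is all-depths `j + 2 ≤ K`); the shallow-side row LINE 27's (T)∕(M) would consume.  CONDITIONAL on `hSh`.
[cite: Balaban1985UV3, (7) p.257] [cite: GrossCMP1983, Thm 2.2] -/
theorem shallowQuantile_of_shallowSecondMoment
    (hSh : ∀ (L : ℕ), ∃ N₁ : ℕ, 0 < N₁ ∧ ∃ C : ℝ, 0 ≤ C ∧ ∃ γ₁ : ℝ, 0 < γ₁ ∧ γ₁ ≤ 1 ∧
      ∀ (F : T3Family) (γ : ℝ), F.L = L → 0 < γ → γ ≤ γ₁ → ∀ (K j : ℕ), 1 ≤ j → N₁ * j ≤ K →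
        ∀ a : Plaq (F.P K) j,
          ∫ U, (GaugeGroup.dist1 (GaugeField.plaqHol
              (Averaging.iter (fun i' => BlockAveraging.blockAvg (P := F.P K) (j := i') ℰp) j U) a)) ^ 2 ∂(gibbsK F ℰp γ K)
            ≤ C * (γ * ((F.L : ℝ)⁻¹) ^ (K - j))) :
    ∀ (L : ℕ), ∃ N₁ : ℕ, 0 < N₁ ∧ ∀ (b₀ p₀ : ℝ), 0 < b₀ → 2 < p₀ → ∃ γ₁ : ℝ, 0 < γ₁ ∧ γ₁ ≤ 1 ∧
      ∀ (F : T3Family) (γ : ℝ), F.L = L → 0 < γ → γ ≤ γ₁ → ∀ (K j : ℕ), 1 ≤ j → N₁ * j ≤ K →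
        ∀ a : Plaq (F.P K) j,
          3 / 4 ≤ (gibbsK F ℰp γ K).real {U : GaugeField (F.P K) 0 (Matrix.specialUnitaryGroup (Fin 2) ℂ) | GaugeGroup.dist1 (GaugeField.plaqHol (Averaging.iter (fun i' => BlockAveraging.blockAvg (P := F.P K) (j := i') ℰp) j U) a) ≤ θBal F.L γ b₀ p₀ (K - j) / 8} := by
  intro L
  obtain ⟨N₁, hN₁, H⟩ := secondMomentTheta_of_shallowSecondMoment hSh L
  refine ⟨N₁, hN₁, fun b₀ p₀ hb₀ hp₀ => ?_⟩
  obtain ⟨γ₁, hγ₁, hγ₁1, H1⟩ := H b₀ p₀ hb₀ hp₀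
  refine ⟨γ₁, hγ₁, hγ₁1, ?_⟩
  intro F γ hFL hγ hγle K j hj hjK a
  have hsq := H1 F γ hFL hγ hγle K j hj hjK a
  haveI : IsProbabilityMeasure (gibbsK F ℰp γ K) := isProbabilityMeasure_gibbsK F ℰp hγ.le K
  have hL1 : 1 ≤ F.L := le_of_lt F.hL.2
  have hθpos : 0 < θBal F.L γ b₀ p₀ (K - j) := θBal_pos hL1 hγ (hγle.trans hγ₁1) hb₀ p₀ (K - j)
  have hfm : Measurable fun U : GaugeField (F.P K) 0 (Matrix.specialUnitaryGroup (Fin 2) ℂ) =>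
      GaugeGroup.dist1 (GaugeField.plaqHol (Averaging.iter (fun i' => BlockAveraging.blockAvg (P := F.P K) (j := i') ℰp) j U) a) :=
    RegularGaugeGroup.measurable_dist1.comp ((Missing.measurable_plaqHol a).comp
      (T4Continuum.measurable_iter _ (F.avgMeasurable_of_measurableE ℰp measurableE_ℰp K) j))
  exact threeQuarters_of_sq_integral (μ := gibbsK F ℰp γ K) hθpos hfm (fun U => GaugeGroup.dist1_nonneg _)
    (fun U => T4PairDerivBridge.dist1_le_two_specialUnitaryGroup _) hsq

/-! ## §5 Corollary: the K2-lane face with the variance row cut at LINE 28's depth line -/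

/-- ★★ **COROLLARY — `HistoryTailL` (stmt-QuantumFields-19936) from K1-exp, the named print fact `MinimisingTangentMapConstant`, LINE 28's SHALLOW lemma and the
DEEP first-moment crux `MeanDeviationDeepL`** — `historyTailL_of_tangentMapFact hK1 hT (meanDeviationL_of_shallowSecondMoment_deep' hSh hDeep)` (LEAD K-13's face
✓ `PoincareLipschitzHistoryTailOfTangentMapFact` fed by §3).  Not a display (RULING №28: faces are the LEAD's); a by-name corollary recording where LINE 28's card cuts
the v10 variance row.  CONDITIONAL on all four binders; `HistoryTailL` is NOT proved. [cite: Balaban1985UV3, (71) p.273] [cite: GrossCMP1983, Thm 2.2] -/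
theorem historyTailL_of_tangentMapFact_shallowSecondMoment_deep
    (hK1 : ∀ (L : ℕ), ∃ (Cc cc : ℝ), 0 ≤ Cc ∧ 0 < cc ∧ ∃ γ₁ : ℝ, 0 < γ₁ ∧ γ₁ ≤ 1 ∧
      ∀ (F : T3Family) (γ : ℝ), F.L = L → 0 < γ → γ ≤ γ₁ → ∀ (K n : ℕ), 1 ≤ n →
        (n : ℝ) ≤ (F.scheme ℰp γ).β K → 2 * n ≤ (F.P K).sitesPerDir 0 →
        ∀ (x₀ : Site (F.P K) 0) (f : GaugeField (F.P K) 0 (Matrix.specialUnitaryGroup (Fin 2) ℂ) → ℝ) (Λ : ℝ), 0 < Λ →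
          Measurable f → GaugeField.GaugeInvariant f →
          (∀ U U' : GaugeField (F.P K) 0 (Matrix.specialUnitaryGroup (Fin 2) ℂ),
            (∀ b : PBond (F.P K) 0, (∀ k, (b.src k - x₀ k).val < n) → (∀ k, (b.tgt k - x₀ k).val < n) → U b = U' b) →
              f U = f U') →
          (∀ U U' : GaugeField (F.P K) 0 (Matrix.specialUnitaryGroup (Fin 2) ℂ),
            |f U - f U'| ≤ Λ * Real.sqrt (∑ b : PBond (F.P K) 0, GaugeGroup.dist1 (U b * (U' b)⁻¹) ^ 2)) →
          ∀ r : ℝ, 0 ≤ r →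
            (gibbsK F ℰp γ K).real {U | r ≤ f U - ∫ V, f V ∂(gibbsK F ℰp γ K)} ≤
              Cc * Real.exp (-(cc * Real.sqrt ((F.scheme ℰp γ).β K) * r / ((n : ℝ) * Λ))))
    (hT : Literature.Analysis.PDE.MinimisingTangentMapConstant)
    (hSh : ∀ (L : ℕ), ∃ N₁ : ℕ, 0 < N₁ ∧ ∃ C : ℝ, 0 ≤ C ∧ ∃ γ₁ : ℝ, 0 < γ₁ ∧ γ₁ ≤ 1 ∧
      ∀ (F : T3Family) (γ : ℝ), F.L = L → 0 < γ → γ ≤ γ₁ → ∀ (K j : ℕ), 1 ≤ j → N₁ * j ≤ K →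
        ∀ a : Plaq (F.P K) j,
          ∫ U, (GaugeGroup.dist1 (GaugeField.plaqHol
              (Averaging.iter (fun i' => BlockAveraging.blockAvg (P := F.P K) (j := i') ℰp) j U) a)) ^ 2 ∂(gibbsK F ℰp γ K)
            ≤ C * (γ * ((F.L : ℝ)⁻¹) ^ (K - j)))
    (hDeep : Summit.QuantumFields.YangMills.Theses.RevelationMartingale.MeanDeviationDeepL) :
    Summit.QuantumFields.YangMills.Theses.UnitScaleTilt.HistoryTailL :=
  Summit.QuantumFields.YangMills.Theorems.PoincareLipschitzHistoryTailOfTangentMapFact.historyTailL_of_tangentMapFact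
    hK1 hT (meanDeviationL_of_shallowSecondMoment_deep' hSh hDeep)

end Summit.QuantumFields.YangMills.Theorems.PoincareLipschitzMeanDeviationOfShallowSecondMoment
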